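import Summits.QuantumFields.YangMills.Theorems.TwistedTraceScaling.Negative.AvgKernelNoUntwistedStiffFactor
import Summits.QuantumFields.YangMills.Theorems.LuscherReductionTwistedTraceScalingSliceCoerciveBased
import Summits.QuantumFields.YangMills.Theorems.LuscherReductionTwistedTraceScalingAxisRotation
import HarnessLib

/-!
# R33c — the stiff flip pair ON THE FADDEEV–POPOV SLICE: a divergence-free (plaquette-loop) transverse stiff witness puts both tube points of R33's flip on
# lane A's slice `T = {gaugeCoordSq = 0}` (crux disprover of `TwistedTraceScaling`, stmt-QuantumFields-20203, cycle 26; `--supports` the crux; negative lane, def-free)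

R33/R33b killed every pointwise «slow factor × untwisted stiff factor» model of the averaged kernel `K̃_β = avgKernel β` on the CORE TUBE POINTS `orthoTube u v`.
Lane A's display (COARSE-DESIGN §23.2 (3), §23.7) is claimed «on `T × T`», `T` the Faddeev–Popov slice through the tube: `gaugeCoordSq L U = 0` with
`gaugeCoordSq U = ‖P_{gaugeModes}(relLinkVec U)‖²`, `gaugeModes = range vacGrad` (`LuscherReductionTwistedTraceScalingRecordWeight`).  R33's antipodal stiff witness
(`± a` on the two links `(0,k)`, `(x₁,k)`) has nonzero lattice divergence, so its tube points are NOT on `T` — a loophole.  This file closes it.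
* ★ `exists_loop_witness` — the PLAQUETTE-LOOP stiff datum `v^□` (`+a e₁` on `(0,0)`, `(0̂,1)`, `−a e₁` on `(1̂,0)`, `(0,1)`: the oriented boundary of a plaquette,
  colour `e₁ ⊥` the torus axis): capped, balanced, transverse, `Σ_e|v_e|² = 4a²`, `Σ_e|v_e| = 4a`, sup-size `a`, and `linkEmbed v^□ ⊥ gaugeModes` (every lattice
  gradient integrates to zero around a closed loop — the linearised slice condition `vacGrad† v = 0`).
* `relLinkVec_orthoTube_chart`, `gaugeCoordSq_orthoTube_chart_eq_zero` — by lane A's own `basedFn_zero_left` (at based gauge parameter `ξ = 0`), the relative-link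
  coordinate of a small tube point over chart-form slow data IS its stiff datum, so the point is on `T` iff the stiff datum is divergence-free.
* `diagSU2_eq_chartSU2` — abelian diagonal slow data are chart-form (`diag(e^{iθ},e^{−iθ}) = P((sin θ)e₁)`, `|θ| ≤ 1`).
* ★★ `exists_slice_flip_pair` — for `2 ≤ L`, `0 ≤ s`, `0 < a ≤ β^{−s}/32`: slow datum `u_θ`, `θ = β^{−s}/(40·#E)` (core scale, not the vacuum), stiff data `± v^□`:
  BOTH tube points are core points (capped balanced; slow links, all links, both `orbitDist` `< β^{−s}`), BOTH are ON THE SLICE, they are gauge equivalent by the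
  constant gauge transformation `diag(i,−i)` (`K̃_β(U,V) = K̃_β(U,U)`, R33), and `K_β(U,V) = e^{−16βa²}K_β(U,U)` exactly (R33 `transferKernel_orthoTube_diag_neg`).
The no-go theorems on the slice are in the companion file `AvgKernelNoStiffFactorOnSlice` (R33d).
READING (as R33): the slice `T` fixes the gauge modes `range vacGrad` only; the CONSTANT gauge transformations are the kernel of `vacGrad` and survive on `T` as the
residual global colour group, whose stabiliser of an abelian slow datum still acts on the stiff datum — the twist cannot be dropped on `T × T` either.  REPAIR `C′`:
the jointly twisted product `∫ K₁^{L³β}(u, Ad_g u′)·G_st(w, R_g w′) dg` (missed by the witness, see R33b).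
HONEST FRAMING: statements about one displayed intermediate formula of lane A's design for stub S-BASE/C4-CORE of a child of the CONDITIONAL reduction route R2b1
(`LuscherReduction`); nothing here refutes `TwistedTraceScaling`, C4, or any registered statement; not a gap, not Clay.

## References
* M. Lüscher, Some analytic results concerning the mass spectrum of Yang–Mills gauge theories on a torus, Nucl. Phys. B219 (1983) 233–261, §3 (constant modes,
  residual global gauge group of the effective problem). [Luscher1983]
* E. Seiler, Gauge Theories as a Problem of Constructive Quantum Field Theory and Statistical Mechanics, LNP 159 (1982), §3. [SeilerLNP1982]
-/

set_option autoImplicit false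

noncomputable section

open Real Filter Topology
open Literature.MathematicalPhysics.QuantumFieldTheory hiding SU2
open Literature.MathematicalPhysics.QuantumLattice

namespace Summit.QuantumFields.YangMills.Theorems.TwistedTraceScaling.Negative.R33c

open Summit.QuantumFields.YangMills.Theorems.FemtoTransferGap
open Summit.QuantumFields.YangMills.Theorems.FemtoTransferGap.TwoLattice.Avg
open Summit.QuantumFields.YangMills.Theorems.FemtoTransferGap.TwoLattice.ConstTube
open Summit.QuantumFields.YangMills.Theorems.FemtoTransferGap.TwoLattice.Stiff (LinkSpace)
open Summit.QuantumFields.YangMills.Theorems.FemtoTransferGap.TwoLattice.Flat (scalarPart_diagSU2 vecPart_diagSU2)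
open Summit.QuantumFields.YangMills.Theorems.FemtoTransferGap.TwoLattice.Toron (frobNorm_diagSU2_sub_one_le)
open Summit.QuantumFields.YangMills.Theorems.TwistedTraceScaling.Negative.R33
open Summit.QuantumFields.YangMills.Theorems.TwistedTraceScaling.Negative.R33b (kinetic_tolerance_aux)

variable {L : ℕ} [NeZero L]

/-! ## §1 The plaquette-loop stiff witness: transverse, capped, balanced AND divergence-free -/

/-- Gauge modes pair with an embedded link field edge by edge. [folklore] -/
theorem inner_vacGrad_linkEmbed (φ : Site 3 L → Fin 3 → ℝ) (v : Edge 3 L → Fin 3 → ℝ) :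
    @inner ℝ _ _ (vacGrad L φ) (linkEmbed L v) = ∑ e : Edge 3 L, ∑ b : Fin 3, (φ (e.1.shift e.2) b - φ e.1 b) * v e b := by
  rw [PiLp.inner_apply, Fintype.sum_prod_type]
  refine Finset.sum_congr rfl fun e _ => Finset.sum_congr rfl fun b _ => ?_
  rw [vacGrad_apply, linkEmbed_apply, Real.inner_apply]

/-- A two-point signed profile integrates a function to a difference. [folklore] -/
theorem sum_twoPoint_mul (p q : Site 3 L) (h : Site 3 L → ℝ) :
    ∑ x, ((if x = p then (1 : ℝ) else 0) - (if x = q then 1 else 0)) * h x = h p - h q := by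
  simp only [sub_mul, Finset.sum_sub_distrib, ite_mul, one_mul, zero_mul, Finset.sum_ite_eq', Finset.mem_univ, if_true]

omit [NeZero L] in
/-- Squares and absolute values of a two-point signed profile with distinct points. [folklore] -/
theorem twoPoint_sq_abs {p q : Site 3 L} (hpq : p ≠ q) (x : Site 3 L) :
    ((if x = p then (1 : ℝ) else 0) - (if x = q then 1 else 0)) ^ 2 = (if x = p then (1 : ℝ) else 0) + (if x = q then 1 else 0) ∧
      |((if x = p then (1 : ℝ) else 0) - (if x = q then 1 else 0))| = (if x = p then (1 : ℝ) else 0) + (if x = q then 1 else 0) := by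
  by_cases hp : x = p
  · have hq : ¬ x = q := fun h => hpq (hp.symm.trans h)
    rw [if_pos hp, if_neg hq]; norm_num
  · by_cases hq : x = q
    · rw [if_neg hp, if_pos hq]; norm_num
    · rw [if_neg hp, if_neg hq]; norm_num

/-- ★ **The plaquette-loop stiff witness.**  For `2 ≤ L` and `0 < a ≤ 1/2`: the stiff datum `v^□` carrying `+a·e₁` on the links `(0,0)`, `(0̂,1)` and `−a·e₁`
on `(1̂,0)`, `(0,1)` — the oriented boundary of the plaquette at the origin in the `(0,1)`-plane, colour `e₁ ⊥` the torus axis `e₀` — is capped, balanced,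
transverse, of kinetic size `Σ_e|v_e|² = 4a²`, `Σ_e|v_e| = 4a`, sup-size `a`, and DIVERGENCE-FREE: `linkEmbed v ⊥ gaugeModes` (a closed loop integrates every
lattice gradient to zero), i.e. it satisfies the linearised Faddeev–Popov slice condition. [cite: Luscher1983, §3] -/
theorem exists_loop_witness (hL : 2 ≤ L) {a : ℝ} (ha0 : 0 < a) (ha : a ≤ 1 / 2) :
    ∃ v : Edge 3 L → Fin 3 → ℝ, v ∈ capBalancedSet L ∧ (∀ e, v e 0 = 0) ∧ (∀ e, ∑ b, v e b ^ 2 ≤ a ^ 2) ∧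
      ∑ e, ∑ b, v e b ^ 2 = 4 * a ^ 2 ∧ ∑ e, Real.sqrt (∑ b, v e b ^ 2) = 4 * a ∧ (∀ e b, |v e b| ≤ a) ∧
      linkEmbed L v ∈ (gaugeModes L)ᗮ := by
  haveI : Fact (1 < L) := ⟨hL⟩
  -- the plaquette corners `xA = 0̂`, `xB = 1̂`
  set xA : Site 3 L := (0 : Site 3 L).shift 0 with hxA
  set xB : Site 3 L := (0 : Site 3 L).shift 1 with hxB
  have hA0 : (0 : Site 3 L) ≠ xA := fun h => by
    have := congr_fun h 0
    simp [hxA, Site.shift] at this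
  have hB0 : (0 : Site 3 L) ≠ xB := fun h => by
    have := congr_fun h 1
    simp [hxB, Site.shift] at this
  have hcomm : xA.shift 1 = xB.shift 0 := by simp only [hxA, hxB, Site.shift]; exact add_right_comm _ _ _
  -- the two site profiles: direction 0 carries `δ_0 − δ_{xB}`, direction 1 carries `δ_{xA} − δ_0`
  set σ₀ : Site 3 L → ℝ := fun x => (if x = 0 then 1 else 0) - (if x = xB then 1 else 0) with hσ₀
  set σ₁ : Site 3 L → ℝ := fun x => (if x = xA then 1 else 0) - (if x = 0 then 1 else 0) with hσ₁
  have hσ₀s : ∑ x, σ₀ x = 0 := by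
    simp only [hσ₀, Finset.sum_sub_distrib, Finset.sum_ite_eq', Finset.mem_univ, if_true, sub_self]
  have hσ₁s : ∑ x, σ₁ x = 0 := by
    simp only [hσ₁, Finset.sum_sub_distrib, Finset.sum_ite_eq', Finset.mem_univ, if_true, sub_self]
  have h0 := fun x => twoPoint_sq_abs (L := L) hB0 x
  have h1 := fun x => twoPoint_sq_abs (L := L) hA0.symm x
  have hσ₀2 : ∑ x, σ₀ x ^ 2 = 2 := by
    simp only [hσ₀, fun x => (h0 x).1, Finset.sum_add_distrib, Finset.sum_ite_eq', Finset.mem_univ, if_true]; norm_num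
  have hσ₁2 : ∑ x, σ₁ x ^ 2 = 2 := by
    simp only [hσ₁, fun x => (h1 x).1, Finset.sum_add_distrib, Finset.sum_ite_eq', Finset.mem_univ, if_true]; norm_num
  have hσ₀a : ∑ x, |σ₀ x| = 2 := by
    simp only [hσ₀, fun x => (h0 x).2, Finset.sum_add_distrib, Finset.sum_ite_eq', Finset.mem_univ, if_true]; norm_num
  have hσ₁a : ∑ x, |σ₁ x| = 2 := by
    simp only [hσ₁, fun x => (h1 x).2, Finset.sum_add_distrib, Finset.sum_ite_eq', Finset.mem_univ, if_true]; norm_num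
  have hσle : ∀ (p q x : Site 3 L), ((if x = p then (1 : ℝ) else 0) - (if x = q then 1 else 0)) ^ 2 ≤ 1 := by
    intro p q x
    by_cases hp : x = p
    · by_cases hq : x = q
      · rw [if_pos hp, if_pos hq]; norm_num
      · rw [if_pos hp, if_neg hq]; norm_num
    · by_cases hq : x = q
      · rw [if_neg hp, if_pos hq]; norm_num
      · rw [if_neg hp, if_neg hq]; norm_num
  -- the edge profile
  set c : Edge 3 L → ℝ := fun e => (if e.2 = 0 then σ₀ e.1 else 0) + (if e.2 = 1 then σ₁ e.1 else 0) with hc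
  have hc0 : ∀ x, c (x, 0) = σ₀ x := fun x => by simp [hc]
  have hc1 : ∀ x, c (x, 1) = σ₁ x := fun x => by simp [hc]
  have hc2 : ∀ x, c (x, 2) = 0 := fun x => by simp [hc]
  have hcle : ∀ e, c e ^ 2 ≤ 1 := by
    rintro ⟨x, k⟩
    fin_cases k
    · show c (x, 0) ^ 2 ≤ 1
      rw [hc0]; exact hσle 0 xB x
    · show c (x, 1) ^ 2 ≤ 1
      rw [hc1]; exact hσle xA 0 x
    · show c (x, 2) ^ 2 ≤ 1
      rw [hc2]; norm_num
  have hcsq : ∑ e, c e ^ 2 = 4 := by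
    rw [Fintype.sum_prod_type, Finset.sum_comm]
    simp only [Fin.sum_univ_three, hc0, hc1, hc2]
    rw [hσ₀2, hσ₁2]; norm_num
  have hcabs : ∑ e, |c e| = 4 := by
    rw [Fintype.sum_prod_type, Finset.sum_comm]
    simp only [Fin.sum_univ_three, hc0, hc1, hc2, abs_zero]
    rw [hσ₀a, hσ₁a]; norm_num
  have hcsum : ∀ g : Edge 3 L → ℝ, ∑ e, c e * g e = g (0, 0) - g (xB, 0) + (g (xA, 1) - g (0, 1)) := by
    intro g
    rw [Fintype.sum_prod_type, Finset.sum_comm]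
    simp only [Fin.sum_univ_three, hc0, hc1, hc2, zero_mul, Finset.sum_const_zero, add_zero]
    rw [hσ₀, hσ₁, sum_twoPoint_mul, sum_twoPoint_mul]
  have hcbal : ∀ k : Fin 3, ∑ x : Site 3 L, c (x, k) = 0 := by
    intro k
    fin_cases k
    · show ∑ x : Site 3 L, c (x, 0) = 0
      simp only [hc0]; exact hσ₀s
    · show ∑ x : Site 3 L, c (x, 1) = 0
      simp only [hc1]; exact hσ₁s
    · show ∑ x : Site 3 L, c (x, 2) = 0
      simp [hc2]
  have hcabs1 : ∀ e, |c e| ≤ 1 := fun e => by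
    have := hcle e
    rw [← sq_abs] at this
    nlinarith [abs_nonneg (c e)]
  -- the colour vector `w = a e₁`
  set w : Fin 3 → ℝ := Pi.single 1 a with hw
  have hw0 : w 0 = 0 := by simp [hw]
  have hw2 : ∑ b, w b ^ 2 = a ^ 2 := by simp [hw, Fin.sum_univ_three]
  have hwb : ∀ b, |w b| ≤ a := fun b => by
    fin_cases b <;> simp [hw, abs_of_pos ha0, ha0.le]
  have hve : ∀ e, ∑ b, (c e * w b) ^ 2 = c e ^ 2 * a ^ 2 := fun e => by
    simp only [mul_pow]; rw [← Finset.mul_sum, hw2]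
  refine ⟨fun e b => c e * w b, ⟨fun k b => ?_, fun e => ?_⟩, fun e => by simp [hw0], fun e => ?_, ?_, ?_, fun e b => ?_, ?_⟩
  · rw [← Finset.sum_mul, hcbal k, zero_mul]
  · rw [hve]
    have ha2 : a ^ 2 ≤ 1 / 4 := by nlinarith
    nlinarith [hcle e, sq_nonneg a]
  · rw [hve]; nlinarith [hcle e, sq_nonneg a]
  · simp only [hve]; rw [← Finset.sum_mul, hcsq]
  · simp only [hve]
    have : ∀ e, Real.sqrt (c e ^ 2 * a ^ 2) = |c e| * a := fun e => by
      rw [show c e ^ 2 * a ^ 2 = (c e * a) ^ 2 by ring, Real.sqrt_sq_eq_abs, abs_mul, abs_of_pos ha0]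
    simp only [this]; rw [← Finset.sum_mul, hcabs]
  · rw [abs_mul]
    calc |c e| * |w b| ≤ 1 * a := mul_le_mul (hcabs1 e) (hwb b) (abs_nonneg _) zero_le_one
      _ = a := one_mul a
  · -- divergence-free: every gradient integrates to zero around the closed loop
    rw [Submodule.mem_orthogonal]
    rintro _ ⟨φ, rfl⟩
    rw [inner_vacGrad_linkEmbed]
    have hinner : ∀ e : Edge 3 L, ∑ b, (φ (e.1.shift e.2) b - φ e.1 b) * (c e * w b) = c e * (a * (φ (e.1.shift e.2) 1 - φ e.1 1)) := by
      intro e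
      simp only [hw, Fin.sum_univ_three, Pi.single_apply]
      simp
      ring
    simp only [hinner]
    rw [hcsum]
    rw [show (0 : Site 3 L).shift 0 = xA from rfl, show (0 : Site 3 L).shift 1 = xB from rfl, hcomm]
    ring

/-! ## §2 The Faddeev–Popov slice coordinate of a small tube point is its stiff datum -/

/-- On small tube points over chart-form slow data the transverse (relative-link) coordinate is the embedded stiff datum itself — lane A's
`basedFn_zero_left` read at the based gauge parameter `ξ = 0`. [folklore] -/
theorem relLinkVec_orthoTube_chart {v : Edge 3 L → Fin 3 → ℝ} (hv : v ∈ balancedSet L) (hvs : ∀ e b, |v e b| ≤ 1 / 20)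
    {c : Fin 3 → Fin 3 → ℝ} (hcs : ∀ k j, |c k j| ≤ 1 / 40) :
    relLinkVec L (orthoTube L (fun e₁ : Edge 3 1 => chartSU2 (c e₁.2)) v) = linkEmbed L v := by
  have hw : ‖(⟨v, hv⟩ : balancedSubmodule L)‖ ≤ 1 / 20 := by
    rw [← Submodule.norm_coe]
    exact (pi_norm_le_iff_of_nonneg (by norm_num)).mpr fun e =>
      (pi_norm_le_iff_of_nonneg (by norm_num)).mpr fun b => by rw [Real.norm_eq_abs]; exact hvs e b
  have hc : ‖c‖ ≤ 1 / 40 :=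
    (pi_norm_le_iff_of_nonneg (by norm_num)).mpr fun k => (pi_norm_le_iff_of_nonneg (by norm_num)).mpr fun j => by
      rw [Real.norm_eq_abs]; exact hcs k j
  have h := basedFn_zero_left L (⟨v, hv⟩, c) hw hc
  have h1 : (fun x : Site 3 L => chartSU2 (((0 : basedSubmodule L) : Site 3 L → Fin 3 → ℝ) x)) = fun _ => (1 : SU2) := by
    funext x
    rw [ZeroMemClass.coe_zero, Pi.zero_apply, chartSU2_zero']
  have h2 : ∀ U : GaugeConfig 3 L SU2, gaugeTransform (fun _ : Site 3 L => (1 : SU2)) U = U := fun U => by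
    funext e
    show 1 * U e * 1⁻¹ = U e
    rw [inv_one, one_mul, mul_one]
  unfold basedFn actCfg at h
  rw [basedIncl_apply] at h
  dsimp only at h
  rw [h1, h2] at h
  exact h

/-- Hence such a tube point lies ON lane A's slice `T = {gaugeCoordSq = 0}` as soon as its stiff datum is divergence-free (`linkEmbed v ⊥ gaugeModes`). [folklore] -/
theorem gaugeCoordSq_orthoTube_chart_eq_zero {v : Edge 3 L → Fin 3 → ℝ} (hv : v ∈ balancedSet L) (hvs : ∀ e b, |v e b| ≤ 1 / 20)
    {c : Fin 3 → Fin 3 → ℝ} (hcs : ∀ k j, |c k j| ≤ 1 / 40) (hperp : linkEmbed L v ∈ (gaugeModes L)ᗮ) :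
    gaugeCoordSq L (orthoTube L (fun e₁ : Edge 3 1 => chartSU2 (c e₁.2)) v) = 0 := by
  unfold gaugeCoordSq
  rw [relLinkVec_orthoTube_chart hv hvs hcs, (Submodule.starProjection_apply_eq_zero_iff _).mpr hperp, norm_zero]
  norm_num

/-! ## §3 Abelian diagonal slow data in chart form -/

/-- `diag(e^{iθ}, e^{−iθ}) = P((sin θ)e₁)` for `|θ| ≤ 1` (nonnegative scalar part). [folklore] -/
theorem diagSU2_eq_chartSU2 {θ : ℝ} (hθ : |θ| ≤ 1) : diagSU2 θ = chartSU2 ![Real.sin θ, 0, 0] := by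
  rw [← vecPart_diagSU2 θ, chartSU2_vecPart]
  rw [scalarPart_diagSU2]
  have h := abs_le.mp hθ
  exact Real.cos_nonneg_of_mem_Icc ⟨by linarith [Real.pi_gt_three], by linarith [Real.pi_gt_three]⟩

/-- The chart coordinates of small diagonal slow data are small. [folklore] -/
theorem abs_diagChart_le (θ : Fin 3 → ℝ) (k j : Fin 3) : |(![Real.sin (θ k), 0, 0] : Fin 3 → ℝ) j| ≤ |θ k| := by
  fin_cases j
  · simpa using Real.abs_sin_sub_sin_le (θ k) 0
  · simp
  · simp

/-! ## §4 ★★ The stiff flip pair ON THE SLICE -/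

/-- ★★ **The stiff flip pair on lane A's Faddeev–Popov slice `T = {gaugeCoordSq = 0}`.**  For `2 ≤ L`, `0 ≤ s` and `0 < a ≤ β^{−s}/32`, at the abelian slow
datum `u_θ = (diag(e^{iθ}, e^{−iθ}))_k`, `θ = β^{−s}/(40·#E)` (core scale, NOT the vacuum), and the plaquette-loop stiff datum `v^□` of amplitude `a`: the two
tube points `U = orthoTube u_θ v^□`, `V = orthoTube u_θ (−v^□)` are BOTH core points of the `twolattice` tube (capped balanced stiff data, all links and both
orbits `< β^{−s}`), BOTH lie on the slice (`gaugeCoordSq U = gaugeCoordSq V = 0`), are gauge equivalent by the constant gauge transformation `diag(i, −i)`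
(so `K̃_β(U,V) = K̃_β(U,U)`), while the un-averaged lattice kernel separates them by the exact factor `e^{−16βa²}`. [cite: Luscher1983, §3] -/
theorem exists_slice_flip_pair (hL : 2 ≤ L) {s : ℝ} (hs0 : 0 ≤ s) (β : ℝ) {a : ℝ} (ha0 : 0 < a) (ha : a ≤ powScale s β / 32) :
    ∃ (u : GaugeConfig 3 1 SU2) (v : Edge 3 L → Fin 3 → ℝ),
      v ∈ capBalancedSet L ∧ -v ∈ capBalancedSet L ∧ (∀ e, v e 0 = 0) ∧
      ∑ e, ∑ b, v e b ^ 2 = 4 * a ^ 2 ∧ ∑ e, ∑ b, (-v) e b ^ 2 = 4 * a ^ 2 ∧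
      (∃ θ : Fin 3 → ℝ, u = fun e : Edge 3 1 => diagSU2 (θ e.2)) ∧
      (∀ e, frobNorm (((u e : SU2) : Matrix (Fin 2) (Fin 2) ℂ) - 1) < powScale s β) ∧
      (∀ e, frobNorm (((orthoTube L u v e : SU2) : Matrix (Fin 2) (Fin 2) ℂ) - 1) < powScale s β) ∧
      (∀ e, frobNorm (((orthoTube L u (-v) e : SU2) : Matrix (Fin 2) (Fin 2) ℂ) - 1) < powScale s β) ∧
      orbitDist (orthoTube L u v) < powScale s β ∧ orbitDist (orthoTube L u (-v)) < powScale s β ∧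
      gaugeCoordSq L (orthoTube L u v) = 0 ∧ gaugeCoordSq L (orthoTube L u (-v)) = 0 ∧
      (∃ g : SU2, orthoTube L u (-v) = gaugeTransform (fun _ : Site 3 L => g) (orthoTube L u v)) ∧
      avgKernel β (orthoTube L u v) (orthoTube L u (-v)) = avgKernel β (orthoTube L u v) (orthoTube L u v) ∧
      transferKernel su2Rep β (orthoTube L u v) (orthoTube L u (-v)) =
        Real.exp (-(16 * β * a ^ 2)) * transferKernel su2Rep β (orthoTube L u v) (orthoTube L u v) := by
  set δ : ℝ := powScale s β with hδdef
  have hδ0 : 0 < δ := powScale_pos s β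
  have hδ1 : δ ≤ 1 := powScale_le_one hs0 β
  have ha2 : a ≤ 1 / 2 := by linarith
  obtain ⟨v, hv, hv0, hve, hvv, hvs, hvb, hperp⟩ := exists_loop_witness (L := L) hL ha0 ha2
  have hv1 : ∀ e : Edge 3 L, ∑ b, v e b ^ 2 ≤ 1 := fun e => sum_sq_le_one_of_cap L hv.2 e
  have hnv : -v ∈ capBalancedSet L := neg_mem_capBalancedSet hv
  have hnv1 : ∀ e : Edge 3 L, ∑ b, (-v) e b ^ 2 ≤ 1 := fun e => sum_sq_le_one_of_cap L hnv.2 e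
  -- the slow angle (core scale)
  set N : ℝ := (Fintype.card (Edge 3 L) : ℝ) with hN
  have hN1 : (1 : ℝ) ≤ N := by rw [hN]; exact_mod_cast Fintype.card_pos
  set θ : ℝ := δ / (40 * N) with hθ
  have hθ0 : 0 < θ := by positivity
  have hθ1 : θ ≤ 1 / 40 := by
    rw [hθ, div_le_div_iff₀ (by positivity) (by norm_num)]
    nlinarith
  have hs2 : Real.sqrt 2 < 2 := (Real.sqrt_lt' (by norm_num)).mpr (by norm_num)
  have hs20 : 0 < Real.sqrt 2 := Real.sqrt_pos.mpr (by norm_num)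
  have huθ : frobNorm (((diagSU2 θ : SU2) : Matrix (Fin 2) (Fin 2) ℂ) - 1) ≤ Real.sqrt 2 * θ := by
    have h := frobNorm_diagSU2_sub_one_le θ; rwa [abs_of_pos hθ0] at h
  have hNθ : N * (Real.sqrt 2 * θ) = Real.sqrt 2 / 40 * δ := by rw [hθ]; field_simp
  have hθδ : Real.sqrt 2 * θ ≤ Real.sqrt 2 / 40 * δ := by
    rw [← hNθ]; exact le_mul_of_one_le_left (by positivity) hN1
  -- per-link stiff sizes
  have hsq : ∀ e, Real.sqrt (∑ b, v e b ^ 2) ≤ a := fun e => by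
    rw [← Real.sqrt_sq ha0.le]; exact Real.sqrt_le_sqrt (hve e)
  have hsqn : ∀ e, Real.sqrt (∑ b, (-v) e b ^ 2) ≤ a := fun e => by rw [sum_sq_neg_apply]; exact hsq e
  set u : GaugeConfig 3 1 SU2 := fun e => diagSU2 ((fun _ : Fin 3 => θ) e.2) with hu
  have hue : ∀ e : Edge 3 L, frobNorm (((u (0, e.2) : SU2) : Matrix (Fin 2) (Fin 2) ℂ) - 1) ≤ Real.sqrt 2 * θ := fun e => huθ
  -- per-link bound for a tube point with stiff sizes `≤ a`
  have hlink : ∀ w : Edge 3 L → Fin 3 → ℝ, (∀ e, ∑ b, w e b ^ 2 ≤ 1) → (∀ e, Real.sqrt (∑ b, w e b ^ 2) ≤ a) →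
      ∀ e, frobNorm (((orthoTube L u w e : SU2) : Matrix (Fin 2) (Fin 2) ℂ) - 1) < δ := by
    intro w hw1 hwa e
    have h := frobNorm_orthoTube_sub_one_le u hw1 e
    have h1 := hwa e
    have h2 := hue e
    nlinarith
  -- orbit bound for a tube point with `Σ_e |w_e| = 4a`
  have horb : ∀ w : Edge 3 L → Fin 3 → ℝ, (∀ e, ∑ b, w e b ^ 2 ≤ 1) → ∑ e, Real.sqrt (∑ b, w e b ^ 2) = 4 * a →
      orbitDist (orthoTube L u w) < δ := by
    intro w hw1 hws
    refine (orbitDist_orthoTube_le u hw1).trans_lt ?_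
    rw [Finset.sum_add_distrib, ← Finset.mul_sum, hws]
    have h1 : ∑ e : Edge 3 L, frobNorm (((u (0, e.2) : SU2) : Matrix (Fin 2) (Fin 2) ℂ) - 1) ≤ N * (Real.sqrt 2 * θ) := by
      have h := Finset.sum_le_sum fun e (_ : e ∈ (Finset.univ : Finset (Edge 3 L))) => hue e
      rwa [Finset.sum_const, Finset.card_univ, nsmul_eq_mul] at h
    rw [hNθ] at h1
    nlinarith
  have hvs' : ∑ e, Real.sqrt (∑ b, (-v) e b ^ 2) = 4 * a := by
    rw [← hvs]; exact Finset.sum_congr rfl fun e _ => by rw [sum_sq_neg_apply]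
  -- slice membership: `u` in chart form, stiff data sup-small and divergence-free
  have hθabs : |θ| ≤ 1 := by rw [abs_of_pos hθ0]; linarith
  set cθ : Fin 3 → Fin 3 → ℝ := fun _ => ![Real.sin θ, 0, 0] with hcθ
  have huc : u = fun e : Edge 3 1 => chartSU2 (cθ e.2) := by
    funext e
    exact diagSU2_eq_chartSU2 hθabs
  have hcs : ∀ k j : Fin 3, |cθ k j| ≤ 1 / 40 := fun k j =>
    (abs_diagChart_le (fun _ => θ) k j).trans (by rw [abs_of_pos hθ0]; exact hθ1)
  have ha20 : a ≤ 1 / 20 := by linarith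
  have hslice : ∀ w : Edge 3 L → Fin 3 → ℝ, w ∈ balancedSet L → (∀ e b, |w e b| ≤ a) → linkEmbed L w ∈ (gaugeModes L)ᗮ →
      gaugeCoordSq L (orthoTube L u w) = 0 := by
    intro w hwb hws hwp
    have key := gaugeCoordSq_orthoTube_chart_eq_zero (L := L) (c := cθ) hwb (fun e b => (hws e b).trans ha20) hcs hwp
    rwa [← huc] at key
  have hnperp : linkEmbed L (-v) ∈ (gaugeModes L)ᗮ := by rw [map_neg]; exact Submodule.neg_mem _ hperp
  refine ⟨u, v, hv, hnv, hv0, hvv, by rw [← hvv]; exact Finset.sum_congr rfl fun e _ => sum_sq_neg_apply v e, ⟨fun _ => θ, rfl⟩,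
    fun _ => huθ.trans_lt (by nlinarith), hlink v hv1 hsq, hlink (-v) hnv1 hsqn, horb v hv1 hvs, horb (-v) hnv1 hvs',
    hslice v hv.1 hvb hperp, hslice (-v) hnv.1 (fun e b => by rw [Pi.neg_apply, Pi.neg_apply, abs_neg]; exact hvb e b) hnperp,
    ⟨diagSU2 (π / 2), (gaugeTransform_halfTurn_orthoTube (fun _ => θ) hv1 hv0).symm⟩,
    avgKernel_orthoTube_diag_neg_right β _ (fun _ => θ) hv1 hv0, ?_⟩
  rw [transferKernel_orthoTube_diag_neg β (fun _ => θ) hv1 hv0, hvv]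
  congr 2
  ring

end Summit.QuantumFields.YangMills.Theorems.TwistedTraceScaling.Negative.R33c

end
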